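import Literature.MathematicalPhysics.QuantumFieldTheory.Balaban1983to89.B5Eq194DivG

/-!
# `Balaban1983to89.B5Eq178Torus` — T. Bałaban, *Propagators and renormalization transformations for
# lattice gauge theories. I*, Commun. Math. Phys. **95** (1984) 17–40 [Balaban1984PropagatorsI]:
# the displays (1.78) and (1.79) of Sect. E (the road from (1.73)/(1.77) to (1.80)/(1.81)) and the
# positivity sentence before (1.80), PROVED for the concrete torus operators

statement-level skeleton of published theorems with citation tags; proofs where landed; nothing here is a claim about the Yang–Mills mass gap

PDF held: `paper:balaban1984-cmp95-propagators-rt-i` (journal page = PDF page + 16); pp. 30–31 read this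
session from the page renders `1984-cmp95-propagators-rt-I-p014-x4.png`, `-p015-x4.png` (not from OCR).

WHAT IS REPRODUCED.  SKELETON row **B5.Eq1.81** ((1.73)–(1.82)) of
`run/shared/lean/pub/lit-balaban/SKELETON.md`, members **(1.78)** (the full vector display — the tree had
only its `∂*`-component, `B5Eq194DivG.divS_eq178`) and **(1.79)**, plus the sentence «φ⁻¹ ≥ α > 0 and
∂₁*φ⁻¹∂₁ ≥ α∂₁*∂₁ = αΔ₀ > 0» by which (1.80) is obtained from (1.79), IN POSITION SPACE for the typed
torus operators.  File 1/2 of Phase-2 seat **p37** (gen 4) of `PHASE2-TARGETS.md` §G (cell `lit-balaban`,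
unit `lit-balaban-p37`, HOME `run/shared/lean/pub/lit-balaban/`); file 2/2 `B5Eq181GTorus` proves (1.81)
and (1.82) from (1.78) + (1.80).  This file declares NO `def`: theorems only.

## The printed text (pp. 30–31; verbatim)

p. 30: «Applying φ⁻¹ to (1.75) we get  QA = φ⁻¹∂₁Q′Δ⁻¹∂*A + φ⁻¹QΔ⁻¹J.   (1.77)
Substituting it in (1.73) and applying Δ⁻¹ we have
  A − ∂Δ⁻²Q′*(Q′Δ⁻²Q′*)⁻¹Q′Δ⁻¹∂*A + aΔ⁻¹Q*φ⁻¹∂₁Q′Δ⁻¹∂*A + aΔ⁻¹Q*φ⁻¹QΔ⁻¹J = Δ⁻¹J.   (1.78)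
Now we will calculate Q′Δ⁻¹∂*A. Let us apply Q′Δ⁻¹∂* to the above equation:»
p. 31: «aQ′Δ⁻²Q′*∂₁*φ⁻¹∂₁Q′Δ⁻¹∂*A + aQ′Δ⁻²Q′*∂₁*φ⁻¹QΔ⁻¹J = Q′Δ⁻²∂*J.   (1.79)
We know that the operator Q′Δ⁻²Q′* is positive on the considered subspace. It is easy to see that
∂₁*φ⁻¹∂₁ is positive also because φ⁻¹ is positive, so φ⁻¹ ≥ α > 0 and ∂₁*φ⁻¹∂₁ ≥ α∂₁*∂₁ = αΔ₀ > 0.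
Thus we obtain from (1.79)
  Q′Δ⁻¹∂*A = (∂₁*φ⁻¹∂₁)⁻¹[a⁻¹(Q′Δ⁻²Q′*)⁻¹Q′Δ⁻²∂*J − ∂₁*φ⁻¹QΔ⁻¹J].   (1.80)»

## Dictionary (the tree's typed torus operators; `T_η = Tor (fine n M)`, unit lattice `T₁^{(k)} = Tor M`,
`n = L^k`, any `d`, `n ≥ 1`, `M_μ ≥ 1`)

`∂ = GradOp (fine n M) n`, `∂* = ∂ᴴ`, `∂₁ = GradOp M 1`, `∂₁* = ∂₁ᴴ`, `Δ₀ = ∂₁*∂₁ = LapS M 1`, scalar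
`Δ⁻¹ = LapSinv (fine n M) n`, `Δ⁻² = Δ⁻¹Δ⁻¹`, componentwise `Δ⁻¹ = B5Phi162Torus.LapVinv` (value `0` on
constants, p. 22), `Q = QvOp`, `Q* = QvAdj = n^d•Qᴴ`, `Q′ = QsOp`, `Q′* = B5Hk160Torus.QsAdj = n^d•Q′ᴴ`
(adjoints for the (1.21)-weighted scalar products), `(Q′Δ⁻²Q′*)⁻¹ = B5Hk160Torus.Einv` (on `1^⊥`),
`P = B5Value126.PcT` ((1.70)), `φ = B5Phi176Torus.Phi176` ((1.76)) with symbol `phi184` ((1.84)),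
`φ⁻¹ = Phi176Inv`, `∂₁*φ⁻¹∂₁ = GPhiE`, `(∂₁*φ⁻¹∂₁)⁻¹ = GPhiEInv`, `Δ_a = B5DeltaA169.DeltaA` ((1.69)/(1.73)).

## What is certified (kernel, zero `sorry`, axioms ⊆ {propext, Classical.choice, Quot.sound})

* §1 **(1.78)** `eq178` — the full vector display, for `Δ_aA = J`, `A ⊥` constants, `a ≥ 0`: obtained AS
  PRINTED by substituting (1.77) (`B5Eq194DivG.eq177`) in (1.73) (`B5Phi176Torus.DeltaA_mulVec'`) and
  applying `Δ⁻¹` (`Δ⁻¹ΔA = A` for `A ⊥ 1`, `Δ⁻¹∂ = ∂Δ⁻¹`, `P` on `∂*A` = (1.70)).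
* §2 **(1.79)** `eq179` — AS PRINTED: «apply Q′Δ⁻¹∂* to the above equation» (1.78), using `∂*∂ = Δ`,
  `Q′Δ⁻²Q′*(Q′Δ⁻²Q′*)⁻¹ = I` on `1^⊥`, `∂*Δ⁻¹ = Δ⁻¹∂*` and `∂*Q* = Q′*∂₁*` ((1.55)*).  ((1.80) is the landed
  `B5Eq194DivG.eq180`, obtained there from the same data; not re-declared.)
* §3 the positivity sentence on the finite torus (`a ≥ 0`): for every `α > 0` with `φ_μ(p′) ≤ α⁻¹` for all
  `μ, p′` one has `φ⁻¹ − αI ⪰ 0` (`Phi176Inv_sub_smul_posSemidef`) and `∂₁*φ⁻¹∂₁ − αΔ₀ ⪰ 0`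
  (`GPhiE_sub_smul_LapS_posSemidef`), Löwner order = `Matrix.PosSemidef` of the difference; and such an
  `α` exists: **`exists_alpha_ineq`** (`α = (1 + a·Σ_μΣ_{p′}φ_μ^{(1.62)}(p′))⁻¹`, ours).  «Q′Δ⁻²Q′* is
  positive on the considered subspace» is the landed `B5Substitution125.Mop_pos`; that `(∂₁*φ⁻¹∂₁)⁻¹`
  exists on `1^⊥` is `B5Phi176Torus.gsymE_ne_zero`/`GPhiEInv_GPhiE_of_orth`.

HONEST SCOPE.  Finite torus (periods `n·M_μ`) instead of the printed `T_η` with `L′_μ → ∞`; complex fields;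
unitary DFT; the constant `α` of §3 is torus-dependent (a finite sum), as on p. 31 — no uniformity is printed
there (the uniform statements are (1.85)–(1.86), `B5Prop11Leaves`).  NOT summit progress.

v1.1 (same seat, APPEND-ONLY): §4 **(1.74)** in full — «a⟨1, Q*QA_μ⟩ = a⟨1, A_μ⟩ = ⟨1, J_μ⟩, so ⟨1, A_μ⟩ =
a⁻¹⟨1, J_μ⟩» (`eq174`, `eq174_mean`; gen 3 had only the corollary `J ⊥ 1 ⇒ A ⊥ 1`,
`B5Phi176Torus.orthConst_of_DeltaA_eq`), and its operator form `P₀G = a⁻¹P₀` (`B0_G_mulVec`, `P0M_mul_G`; the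
constant part of `GJ` is `a⁻¹J₀`, the companion of (1.82) `GJ₀ = a⁻¹J₀` = `B5Phi176Torus.G_constV`).
-/

open scoped BigOperators Matrix ComplexConjugate ComplexOrder
open Finset Complex

namespace Literature.MathematicalPhysics.QuantumFieldTheory.Balaban1983to89.B5Eq178Torus

open Literature.MathematicalPhysics.QuantumFieldTheory.Balaban1983to89
open Literature.MathematicalPhysics.QuantumFieldTheory.Balaban1983to89.B5Prop11Plancherel (Tor dft fine sOf
  dftV star_dftV_mul)
open Literature.MathematicalPhysics.QuantumFieldTheory.Balaban1983to89.B5Prop11Lower (Lap)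
open Literature.MathematicalPhysics.QuantumFieldTheory.Balaban1983to89.B5Action121 (comp LapS GradOp
  GradOp_conjTranspose_mul_GradOp)
open Literature.MathematicalPhysics.QuantumFieldTheory.Balaban1983to89.B5Block118 (QsOp QvOp)
open Literature.MathematicalPhysics.QuantumFieldTheory.Balaban1983to89.B5LaplaceInverse (LapSinv sum_LapSinv
  LapSinv_LapS_of_orth)
open Literature.MathematicalPhysics.QuantumFieldTheory.Balaban1983to89.B5DeltaA169 (QvAdj dftV_mulVec_apply
  DeltaA)
open Literature.MathematicalPhysics.QuantumFieldTheory.Balaban1983to89.B5Value126 (PcT PcT_mulVec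
  sum_QsOp_LapSinv)
open Literature.MathematicalPhysics.QuantumFieldTheory.Balaban1983to89.B5Bounds167Lattice (phi162
  phi162_nonneg)
open Literature.MathematicalPhysics.QuantumFieldTheory.Balaban1983to89.B5Phi162Torus (eq_of_comp_eq OrthConst
  cMul dft_cMul LapVinv PhiOp)
open Literature.MathematicalPhysics.QuantumFieldTheory.Balaban1983to89.B5Hk160Torus (divS_GradOp_mulVec
  divS_LapVinv QsAdj divS_QvAdj Einv QsAdj_Einv QsOp_LapSinv2_QsAdj_Einv)
open Literature.MathematicalPhysics.QuantumFieldTheory.Balaban1983to89.B5Hk163Torus (dft_mulVec_injective)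
open Literature.MathematicalPhysics.QuantumFieldTheory.Balaban1983to89.B5Phi176Torus (phi184 phi184_pos
  Phi176Inv dft_Phi176Inv GPhiE LapVinv_Lap_of_orthConst LapVinv_GradOp DeltaA_mulVec')
open Literature.MathematicalPhysics.QuantumFieldTheory.Balaban1983to89.B5Eq194DivG (eq177)
open Literature.MathematicalPhysics.QuantumFieldTheory.Balaban1983to89.Beta.VectorPropagatorDict
  (ext_of_mulVec')

noncomputable section

variable {d : ℕ} (n : ℕ) [NeZero n] (M : Fin d → ℕ) [hM : ∀ μ, NeZero (M μ)] (a : ℝ)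

/-! ## §1 (1.78): «Substituting it in (1.73) and applying Δ⁻¹» -/

/-- **(1.78)** «A − ∂Δ⁻²Q′*(Q′Δ⁻²Q′*)⁻¹Q′Δ⁻¹∂*A + aΔ⁻¹Q*φ⁻¹∂₁Q′Δ⁻¹∂*A + aΔ⁻¹Q*φ⁻¹QΔ⁻¹J = Δ⁻¹J» — the
full vector display, for `Δ_aA = J` with `A ⊥` constants (`a ≥ 0`): (1.77) substituted in (1.73) and `Δ⁻¹`
applied (`Δ⁻¹ΔA = A`, `Δ⁻¹∂ = ∂Δ⁻¹`, `P∂*A = Δ⁻¹Q′*(Q′Δ⁻²Q′*)⁻¹Q′Δ⁻¹∂*A` by (1.70)).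
[cite: Balaban1984PropagatorsI, (1.78) p.30] -/
theorem eq178 (ha : 0 ≤ a) {A J : Tor (fine n M) × Fin d → ℂ} (hA : DeltaA n M a *ᵥ A = J)
    (hAo : OrthConst (fine n M) A) :
    A - GradOp (fine n M) (n : ℂ) *ᵥ (LapSinv (fine n M) (n : ℂ) *ᵥ (LapSinv (fine n M) (n : ℂ) *ᵥ
          (QsAdj n M *ᵥ (Einv n M *ᵥ (QsOp n M *ᵥ (LapSinv (fine n M) (n : ℂ) *ᵥ
            ((GradOp (fine n M) (n : ℂ))ᴴ *ᵥ A)))))))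
      + (a : ℂ) • (LapVinv n M *ᵥ (QvAdj n M *ᵥ (Phi176Inv n M a *ᵥ (GradOp M 1 *ᵥ
          (QsOp n M *ᵥ (LapSinv (fine n M) (n : ℂ) *ᵥ ((GradOp (fine n M) (n : ℂ))ᴴ *ᵥ A)))))))
      + (a : ℂ) • (LapVinv n M *ᵥ (QvAdj n M *ᵥ (Phi176Inv n M a *ᵥ (QvOp n M *ᵥ (LapVinv n M *ᵥ J)))))
      = LapVinv n M *ᵥ J := by
  -- apply the componentwise `Δ⁻¹` to (1.73)
  have h := congrArg (fun V => LapVinv n M *ᵥ V) hA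
  rw [DeltaA_mulVec', Matrix.mulVec_add, Matrix.mulVec_sub, Matrix.mulVec_smul,
    LapVinv_Lap_of_orthConst n M hAo, LapVinv_GradOp] at h
  -- (1.70): `P∂*A = Δ⁻¹Q′*(Q′Δ⁻²Q′*)⁻¹Q′Δ⁻¹∂*A`
  have hP : PcT n M (n : ℂ) *ᵥ ((GradOp (fine n M) (n : ℂ))ᴴ *ᵥ A)
      = LapSinv (fine n M) (n : ℂ) *ᵥ (QsAdj n M *ᵥ (Einv n M *ᵥ (QsOp n M *ᵥ
          (LapSinv (fine n M) (n : ℂ) *ᵥ ((GradOp (fine n M) (n : ℂ))ᴴ *ᵥ A))))) := by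
    rw [PcT_mulVec, QsAdj_Einv]
  -- substitute (1.77) for `QA`
  rw [hP, eq177 n M a ha hA hAo, Matrix.mulVec_add, Matrix.mulVec_add, smul_add] at h
  rw [add_assoc]
  exact h

/-! ## §2 (1.79): «Let us apply Q′Δ⁻¹∂* to the above equation» -/

/-- **(1.79)** «aQ′Δ⁻²Q′*∂₁*φ⁻¹∂₁Q′Δ⁻¹∂*A + aQ′Δ⁻²Q′*∂₁*φ⁻¹QΔ⁻¹J = Q′Δ⁻²∂*J» for `Δ_aA = J`, `A ⊥` constants
(`a ≥ 0`): `Q′Δ⁻¹∂*` applied to (1.78) — `Q′Δ⁻¹∂*A` and `Q′Δ⁻¹∂*·∂Δ⁻²Q′*(Q′Δ⁻²Q′*)⁻¹Q′Δ⁻¹∂*A` cancel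
(`∂*∂ = Δ`, `Q′Δ⁻²Q′*(Q′Δ⁻²Q′*)⁻¹ = I` on `1^⊥`), and `∂*Δ⁻¹Q* = Δ⁻¹Q′*∂₁*` ((1.55)*).
[cite: Balaban1984PropagatorsI, (1.79) p.31] -/
theorem eq179 (ha : 0 ≤ a) {A J : Tor (fine n M) × Fin d → ℂ} (hA : DeltaA n M a *ᵥ A = J)
    (hAo : OrthConst (fine n M) A) :
    (a : ℂ) • (QsOp n M *ᵥ (LapSinv (fine n M) (n : ℂ) *ᵥ (LapSinv (fine n M) (n : ℂ) *ᵥ (QsAdj n M *ᵥ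
        ((GradOp M 1)ᴴ *ᵥ (Phi176Inv n M a *ᵥ (GradOp M 1 *ᵥ
          (QsOp n M *ᵥ (LapSinv (fine n M) (n : ℂ) *ᵥ ((GradOp (fine n M) (n : ℂ))ᴴ *ᵥ A))))))))))
      + (a : ℂ) • (QsOp n M *ᵥ (LapSinv (fine n M) (n : ℂ) *ᵥ (LapSinv (fine n M) (n : ℂ) *ᵥ (QsAdj n M *ᵥ
        ((GradOp M 1)ᴴ *ᵥ (Phi176Inv n M a *ᵥ (QvOp n M *ᵥ (LapVinv n M *ᵥ J))))))))
      = QsOp n M *ᵥ (LapSinv (fine n M) (n : ℂ) *ᵥ (LapSinv (fine n M) (n : ℂ) *ᵥ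
          ((GradOp (fine n M) (n : ℂ))ᴴ *ᵥ J))) := by
  have hnc : (n : ℂ) ≠ 0 := by exact_mod_cast NeZero.ne n
  -- apply `Q′Δ⁻¹∂*` to (1.78)
  have h := congrArg (fun V => QsOp n M *ᵥ (LapSinv (fine n M) (n : ℂ) *ᵥ
    ((GradOp (fine n M) (n : ℂ))ᴴ *ᵥ V))) (eq178 n M a ha hA hAo)
  simp only [Matrix.mulVec_add, Matrix.mulVec_sub, Matrix.mulVec_smul] at h
  have hu0 : ∑ y, (QsOp n M *ᵥ (LapSinv (fine n M) (n : ℂ) *ᵥ ((GradOp (fine n M) (n : ℂ))ᴴ *ᵥ A))) y = 0 :=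
    sum_QsOp_LapSinv n M (n : ℂ) _
  -- `Q′Δ⁻¹∂*∂Δ⁻²Q′*(Q′Δ⁻²Q′*)⁻¹u = u` for `u = Q′Δ⁻¹∂*A ⊥ 1`
  have h1 : QsOp n M *ᵥ (LapSinv (fine n M) (n : ℂ) *ᵥ ((GradOp (fine n M) (n : ℂ))ᴴ *ᵥ
        (GradOp (fine n M) (n : ℂ) *ᵥ (LapSinv (fine n M) (n : ℂ) *ᵥ (LapSinv (fine n M) (n : ℂ) *ᵥ
          (QsAdj n M *ᵥ (Einv n M *ᵥ (QsOp n M *ᵥ (LapSinv (fine n M) (n : ℂ) *ᵥ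
            ((GradOp (fine n M) (n : ℂ))ᴴ *ᵥ A))))))))))
      = QsOp n M *ᵥ (LapSinv (fine n M) (n : ℂ) *ᵥ ((GradOp (fine n M) (n : ℂ))ᴴ *ᵥ A)) := by
    rw [divS_GradOp_mulVec (fine n M) (n : ℂ),
      LapSinv_LapS_of_orth (fine n M) hnc _ (sum_LapSinv (fine n M) (n : ℂ) _),
      QsOp_LapSinv2_QsAdj_Einv n M _ hu0]
  -- `Q′Δ⁻¹∂*Δ⁻¹Q*v = Q′Δ⁻²Q′*∂₁*v`
  have h2 : ∀ v : Tor M × Fin d → ℂ, QsOp n M *ᵥ (LapSinv (fine n M) (n : ℂ) *ᵥ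
        ((GradOp (fine n M) (n : ℂ))ᴴ *ᵥ (LapVinv n M *ᵥ (QvAdj n M *ᵥ v))))
      = QsOp n M *ᵥ (LapSinv (fine n M) (n : ℂ) *ᵥ (LapSinv (fine n M) (n : ℂ) *ᵥ (QsAdj n M *ᵥ
          ((GradOp M 1)ᴴ *ᵥ v)))) := fun v => by
    rw [divS_LapVinv, divS_QvAdj]
  -- `Q′Δ⁻¹∂*Δ⁻¹J = Q′Δ⁻²∂*J`
  have h3 : QsOp n M *ᵥ (LapSinv (fine n M) (n : ℂ) *ᵥ ((GradOp (fine n M) (n : ℂ))ᴴ *ᵥ (LapVinv n M *ᵥ J)))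
      = QsOp n M *ᵥ (LapSinv (fine n M) (n : ℂ) *ᵥ (LapSinv (fine n M) (n : ℂ) *ᵥ
          ((GradOp (fine n M) (n : ℂ))ᴴ *ᵥ J))) := by
    rw [divS_LapVinv]
  rw [h1, h2, h2, h3, sub_self, zero_add] at h
  exact h

/-! ## §3 «φ⁻¹ ≥ α > 0 and ∂₁*φ⁻¹∂₁ ≥ α∂₁*∂₁ = αΔ₀ > 0» on the finite torus -/

omit [NeZero n] hM in
/-- a componentwise Fourier multiplier is `U*·diag·U` for the vector DFT `U = dftV`. [folklore] -/
private theorem cMul_eq_dftV {N : Fin d → ℕ} [∀ ν, NeZero (N ν)] (m : Fin d → Tor N → ℂ) :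
    cMul N m = star (dftV N) * Matrix.diagonal (fun i : Tor N × Fin d => m i.2 i.1) * dftV N := by
  refine ext_of_mulVec' fun B => ?_
  have hD : dftV N *ᵥ (cMul N m *ᵥ B)
      = Matrix.diagonal (fun i : Tor N × Fin d => m i.2 i.1) *ᵥ (dftV N *ᵥ B) := by
    funext ⟨p, κ⟩
    rw [dftV_mulVec_apply, dft_cMul, Matrix.mulVec_diagonal, dftV_mulVec_apply]
  calc cMul N m *ᵥ B = star (dftV N) *ᵥ (dftV N *ᵥ (cMul N m *ᵥ B)) := by
        rw [Matrix.mulVec_mulVec, star_dftV_mul, Matrix.one_mulVec]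
    _ = (star (dftV N) * Matrix.diagonal (fun i : Tor N × Fin d => m i.2 i.1) * dftV N) *ᵥ B := by
        rw [hD, Matrix.mulVec_mulVec, Matrix.mulVec_mulVec]

omit [NeZero n] hM in
/-- a componentwise Fourier multiplier with non-negative symbol is `⪰ 0`. [folklore] -/
private theorem cMul_posSemidef {N : Fin d → ℕ} [∀ ν, NeZero (N ν)] {m : Fin d → Tor N → ℂ}
    (hm : ∀ μ q, 0 ≤ m μ q) : (cMul N m).PosSemidef := by
  rw [cMul_eq_dftV, Matrix.star_eq_conjTranspose]
  exact (Matrix.PosSemidef.diagonal fun i : Tor N × Fin d => hm i.2 i.1).conjTranspose_mul_mul_same _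

omit [NeZero n] hM in
/-- `cMul m − c·I = cMul (m − c)`. [folklore] -/
private theorem cMul_sub_smul_one {N : Fin d → ℕ} [∀ ν, NeZero (N ν)] (m : Fin d → Tor N → ℂ) (c : ℂ) :
    cMul N m - c • (1 : Matrix (Tor N × Fin d) (Tor N × Fin d) ℂ) = cMul N fun μ q => m μ q - c := by
  refine ext_of_mulVec' fun B => eq_of_comp_eq N fun μ => dft_mulVec_injective N ?_
  funext q
  show (dft N *ᵥ comp N ((cMul N m - c • (1 : Matrix (Tor N × Fin d) (Tor N × Fin d) ℂ)) *ᵥ B) μ) q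
    = (dft N *ᵥ comp N ((cMul N fun μ q => m μ q - c) *ᵥ B) μ) q
  rw [Matrix.sub_mulVec, Matrix.smul_mulVec, Matrix.one_mulVec, dft_cMul]
  have hcs : comp N (cMul N m *ᵥ B - c • B) μ = comp N (cMul N m *ᵥ B) μ - c • comp N B μ := rfl
  rw [hcs, Matrix.mulVec_sub, Matrix.mulVec_smul, Pi.sub_apply, Pi.smul_apply, smul_eq_mul, dft_cMul]
  ring

omit [NeZero n] in
/-- **«φ⁻¹ is positive, so φ⁻¹ ≥ α > 0»**: for every `α > 0` with `φ_μ(p′) ≤ α⁻¹` for all `μ, p′` (symbol (1.84)),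
`φ⁻¹ − αI ⪰ 0` (Löwner order = `Matrix.PosSemidef` of the difference; `a ≥ 0`).
[cite: Balaban1984PropagatorsI, p.31 before (1.80)] -/
theorem Phi176Inv_sub_smul_posSemidef (ha : 0 ≤ a) {α : ℝ} (hα : 0 < α)
    (hle : ∀ μ q, phi184 n M a μ q ≤ α⁻¹) :
    (Phi176Inv n M a - (α : ℂ) • (1 : Matrix (Tor M × Fin d) (Tor M × Fin d) ℂ)).PosSemidef := by
  rw [Phi176Inv, cMul_sub_smul_one]
  refine cMul_posSemidef fun μ q => ?_
  rw [← Complex.ofReal_inv, ← Complex.ofReal_sub]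
  refine Complex.zero_le_real.mpr (sub_nonneg.mpr ?_)
  calc α = (α⁻¹)⁻¹ := (inv_inv _).symm
    _ ≤ (phi184 n M a μ q)⁻¹ := (inv_le_inv₀ (inv_pos.mpr hα) (phi184_pos n M a ha μ q)).mpr (hle μ q)

omit [NeZero n] in
/-- **«and ∂₁*φ⁻¹∂₁ ≥ α∂₁*∂₁ = αΔ₀ > 0»**: for the same `α`, `∂₁*φ⁻¹∂₁ − αΔ₀ ⪰ 0` with `Δ₀ = ∂₁*∂₁ = LapS M 1`
(`∂₁*φ⁻¹∂₁ − αΔ₀ = ∂₁*(φ⁻¹ − αI)∂₁`; `a ≥ 0`). [cite: Balaban1984PropagatorsI, p.31 before (1.80)] -/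
theorem GPhiE_sub_smul_LapS_posSemidef (ha : 0 ≤ a) {α : ℝ} (hα : 0 < α)
    (hle : ∀ μ q, phi184 n M a μ q ≤ α⁻¹) :
    (GPhiE n M a - (α : ℂ) • LapS M 1).PosSemidef := by
  have hmat : GPhiE n M a - (α : ℂ) • LapS M 1
      = (GradOp M 1)ᴴ * (Phi176Inv n M a - (α : ℂ) • (1 : Matrix (Tor M × Fin d) (Tor M × Fin d) ℂ))
          * GradOp M 1 := by
    rw [Matrix.mul_sub, Matrix.sub_mul, Matrix.mul_smul, Matrix.mul_one, Matrix.smul_mul,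
      GradOp_conjTranspose_mul_GradOp, GPhiE]
  rw [hmat]
  exact (Phi176Inv_sub_smul_posSemidef n M a ha hα hle).conjTranspose_mul_mul_same _

omit [NeZero n] in
/-- on the finite torus `φ_μ(p′) = 1 + aφ_μ^{(1.62)}(p′) ≤ 1 + a·Σ_νΣ_q φ_ν^{(1.62)}(q)` (`a ≥ 0`; OUR crude bound —
no uniformity is printed on p. 31). [cite: Balaban1984PropagatorsI, (1.84) p.31] -/
theorem phi184_le_sum (ha : 0 ≤ a) (μ : Fin d) (q : Tor M) :
    phi184 n M a μ q ≤ 1 + a * ∑ ν : Fin d, ∑ q' : Tor M, phi162 n ν (sOf M q') := by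
  rw [phi184]
  have h1 : phi162 n μ (sOf M q) ≤ ∑ q' : Tor M, phi162 n μ (sOf M q') :=
    Finset.single_le_sum (f := fun q' : Tor M => phi162 n μ (sOf M q'))
      (fun q' _ => phi162_nonneg n μ (sOf M q')) (Finset.mem_univ q)
  have h2 : ∑ q' : Tor M, phi162 n μ (sOf M q') ≤ ∑ ν : Fin d, ∑ q' : Tor M, phi162 n ν (sOf M q') :=
    Finset.single_le_sum (f := fun ν : Fin d => ∑ q' : Tor M, phi162 n ν (sOf M q'))
      (fun ν _ => Finset.sum_nonneg fun q' _ => phi162_nonneg n ν (sOf M q')) (Finset.mem_univ μ)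
  exact add_le_add le_rfl (mul_le_mul_of_nonneg_left (h1.trans h2) ha)

omit [NeZero n] in
/-- **the printed sentence in one line** (finite torus, `a ≥ 0`): `∃ α > 0` with `φ⁻¹ − αI ⪰ 0` and
`∂₁*φ⁻¹∂₁ − αΔ₀ ⪰ 0` (witness `α = (1 + a·Σ_νΣ_q φ_ν^{(1.62)}(q))⁻¹`, ours). («Q′Δ⁻²Q′* is positive on the
considered subspace» is `B5Substitution125.Mop_pos`.) [cite: Balaban1984PropagatorsI, p.31 before (1.80)] -/
theorem exists_alpha_ineq (ha : 0 ≤ a) :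
    ∃ α : ℝ, 0 < α
      ∧ (Phi176Inv n M a - (α : ℂ) • (1 : Matrix (Tor M × Fin d) (Tor M × Fin d) ℂ)).PosSemidef
      ∧ (GPhiE n M a - (α : ℂ) • LapS M 1).PosSemidef := by
  have hS : 0 ≤ ∑ ν : Fin d, ∑ q' : Tor M, phi162 n ν (sOf M q') :=
    Finset.sum_nonneg fun ν _ => Finset.sum_nonneg fun q' _ => phi162_nonneg n ν _
  have hpos : 0 < 1 + a * ∑ ν : Fin d, ∑ q' : Tor M, phi162 n ν (sOf M q') := by positivity
  have hα : 0 < (1 + a * ∑ ν : Fin d, ∑ q' : Tor M, phi162 n ν (sOf M q'))⁻¹ := inv_pos.mpr hpos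
  have hle : ∀ μ q, phi184 n M a μ q ≤ ((1 + a * ∑ ν : Fin d, ∑ q' : Tor M, phi162 n ν (sOf M q'))⁻¹)⁻¹ :=
    fun μ q => by rw [inv_inv]; exact phi184_le_sum n M a ha μ q
  exact ⟨_, hα, Phi176Inv_sub_smul_posSemidef n M a ha hα hle, GPhiE_sub_smul_LapS_posSemidef n M a ha hα hle⟩

/-! ## §4 (1.74): the projection of the solution on the constant functions (v1.1 append) -/

open Literature.MathematicalPhysics.QuantumFieldTheory.Balaban1983to89.B5DeltaA169 (isUnit_DeltaA sum_QvAdj_QvOp)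
open Literature.MathematicalPhysics.QuantumFieldTheory.Balaban1983to89.B5Hk160Torus (orthConst_GradOp constV B0
  P0M P0M_mulVec)
open Literature.MathematicalPhysics.QuantumFieldTheory.Balaban1983to89.B5Phi176Torus (orthConst_Lap)

/-- **(1.74)** «For each component A_μ we have from (1.73) a⟨1, Q*QA_μ⟩ = a⟨1, A_μ⟩ = ⟨1, J_μ⟩» for
`Δ_aA = J`: BOTH printed equalities («1 denotes here a function on T_η identically equal to 1»; both scalar
products carry the same weight `η^d`, so `⟨1, f⟩ = η^dΣ_x f(x)` and the weight cancels) — summing the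
`μ`-component of (1.73) over `T_η`, the `Δ`- and `∂P∂*`-terms have no constant part.
[cite: Balaban1984PropagatorsI, (1.74) p.30] -/
theorem eq174 {A J : Tor (fine n M) × Fin d → ℂ} (hA : DeltaA n M a *ᵥ A = J) (μ : Fin d) :
    (a : ℂ) * ∑ x, (QvAdj n M *ᵥ (QvOp n M *ᵥ A)) (x, μ) = (a : ℂ) * ∑ x, A (x, μ)
      ∧ (a : ℂ) * ∑ x, A (x, μ) = ∑ x, J (x, μ) := by
  have hn : 1 ≤ n := Nat.one_le_iff_ne_zero.mpr (NeZero.ne n)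
  have h1 := sum_QvAdj_QvOp n M hn A μ
  refine ⟨by rw [h1], ?_⟩
  have h := congrArg (fun V : Tor (fine n M) × Fin d → ℂ => ∑ x, V (x, μ)) hA
  simp only [DeltaA_mulVec', Pi.add_apply, Pi.sub_apply, Pi.smul_apply, smul_eq_mul,
    Finset.sum_add_distrib, Finset.sum_sub_distrib, ← Finset.mul_sum] at h
  rw [orthConst_Lap n M A μ, (orthConst_GradOp (fine n M) (n : ℂ) _) μ, h1, sub_zero, zero_add] at h
  exact h

/-- **(1.74)** «so ⟨1, A_μ⟩ = a⁻¹⟨1, J_μ⟩» for `Δ_aA = J` (`a ≠ 0`). [cite: Balaban1984PropagatorsI, (1.74) p.30] -/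
theorem eq174_mean (ha : a ≠ 0) {A J : Tor (fine n M) × Fin d → ℂ} (hA : DeltaA n M a *ᵥ A = J) (μ : Fin d) :
    ∑ x, A (x, μ) = (a : ℂ)⁻¹ * ∑ x, J (x, μ) := by
  have ha' : (a : ℂ) ≠ 0 := by exact_mod_cast ha
  rw [← (eq174 n M a hA μ).2, ← mul_assoc, inv_mul_cancel₀ ha', one_mul]

/-- (1.74) for `A = GJ`: the constant part of `GJ` is `a⁻¹J₀` (`J₀ = B0 J` the componentwise mean; `a > 0`) —
«we calculate at first a projection of A on the subspace of constant functions».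
[cite: Balaban1984PropagatorsI, (1.74) p.30] -/
theorem B0_G_mulVec (ha : 0 < a) (J : Tor (fine n M) × Fin d → ℂ) :
    B0 (fine n M) ((DeltaA n M a)⁻¹ *ᵥ J) = (a : ℂ)⁻¹ • B0 (fine n M) J := by
  have hn : 1 ≤ n := Nat.one_le_iff_ne_zero.mpr (NeZero.ne n)
  have hdet := (Matrix.isUnit_iff_isUnit_det _).mp (isUnit_DeltaA n hn M a ha)
  have hA : DeltaA n M a *ᵥ ((DeltaA n M a)⁻¹ *ᵥ J) = J := by
    rw [Matrix.mulVec_mulVec, Matrix.mul_nonsing_inv _ hdet, Matrix.one_mulVec]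
  funext i
  obtain ⟨x, μ⟩ := i
  simp only [B0, constV, Pi.smul_apply, smul_eq_mul]
  rw [eq174_mean n M a ha.ne' hA μ]
  ring

/-- (1.74) as an operator identity: `P₀G = a⁻¹P₀` (`P₀` the constant-mode projection, `G = Δ_a⁻¹`, `a > 0`);
its adjoint companion `GP₀ = a⁻¹P₀` is (1.82) on constants (`B5Phi176Torus.G_constV`).
[cite: Balaban1984PropagatorsI, (1.74) p.30, (1.82) p.31] -/
theorem P0M_mul_G (ha : 0 < a) :
    P0M (fine n M) * (DeltaA n M a)⁻¹ = (a : ℂ)⁻¹ • P0M (fine n M) :=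
  ext_of_mulVec' fun J => by
    rw [← Matrix.mulVec_mulVec, P0M_mulVec, B0_G_mulVec n M a ha J, Matrix.smul_mulVec, P0M_mulVec]

end

end Literature.MathematicalPhysics.QuantumFieldTheory.Balaban1983to89.B5Eq178Torus
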